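import Mathlib.MeasureTheory.Group.Prod
import Mathlib.MeasureTheory.Group.Integral
import Mathlib.MeasureTheory.Function.LpSeminorm.Indicator
import Mathlib.MeasureTheory.Integral.IntervalIntegral.Basic
import Mathlib.Analysis.InnerProductSpace.Dual
import Literature.Analysis.OperatorTheory.L2KernelOperator
import HarnessLib

/-!
# Connes–Consani 2021, Lemma 6.3: `‖𝐊_I − T‖ ≤ ‖τ − ϖ‖_{L¹}` — the operators defined by the
# kernel forms (opkf)/(kT) and their approximation in operator norm — PROVED

A. Connes, C. Consani, *Weil positivity and trace formula, the archimedean place*, Selecta Math.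
(N.S.) 27 (2021), Paper No. 77 = arXiv:2006.13771 [bib: `ConnesConsani2021`]; §6.4, Lemma 6.3
(= Lemma 36 of the arXiv text, p. 24, proof p. 25), together with the way Proposition 5.5
(= Prop. 32, p. 20) introduces the operators: "(i) The following equality defines a bounded operator
`N_I` in the Hilbert space `L²(I, dx)`: `⟨ξ|N_I(ξ)⟩ = E₊(Q₊ f)`, `f = ξ ∗ ξ*`,
`f(v) = ∫ ξ(x) ξ̄(x+v) dx`.  (ii) One has `N_I = −2ε′(1₊)(1 − 𝐊_I)`, where `𝐊_I` is the compact
operator defined by (opkf) `⟨ξ|𝐊_I(ξ)⟩ = (2ε′(1₊))⁻¹ ∫_{−log 2}^{log 2} ∫ ξ(x) ξ̄(x+v) (Qε)(e^{|v|}) dx dv`."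

**What is printed.**  On `𝓗 := L²(I, dx)`, `I = [−½ log 2, ½ log 2]`, the compact operator `𝐊_I`
is thus DEFINED by its quadratic form (opkf)
`⟨ξ | 𝐊_I(ξ)⟩ = ∫_{−log 2}^{log 2} ∫ ξ(x) ξ̄(x+v) ϖ(v) dx dv`, `ϖ(v) = (Qε)(e^{|v|})/(2ε′(1₊))`
(`ξ` extended by zero outside `I`), and the finite-rank
operator `T = λ Σ (𝐤_n − d(|n|) 𝐤_{α_n})` of (opT) "fulfills the equality (kT)
`⟨ξ | T(ξ)⟩ = ∫_{−log 2}^{log 2} ∫ ξ(x) ξ̄(x+v) τ(λ,α,d,m)(v) dx dv`" with the trigonometric sum `τ`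
of (approx0).  **Lemma 6.3**: "Let `τ(λ,α,d,m)(x)` be an approximation of the function `ϖ(x)` so
that the `L¹` norm of the difference `τ(λ,α,d,m) − ϖ` is `≤ ε`.  Then the compact operator `𝐊_I` of
(opkf), for `I = [−½ log 2, ½ log 2]`, is at norm distance less than `ε` from the finite rank
operator `T`."  Printed proof: both operators have quadratic forms of the displayed shape, "thus the
norm of `𝐊_I − T` is bounded by the inequality
`|∫_{−log 2}^{log 2} ∫ ξ(x) ξ(x+v) a(v) dx dv| ≤ ∫_{−log 2}^{log 2} |a(v)| dv`
which follows from the Schwarz inequality `|∫ ξ(x) ξ(x+v) dx| ≤ ‖ξ‖²`" (p. 25).  This is how the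
computed `L¹` number of Fact 6.1 (`2∫₀^{log 2} |τ − ϖ| ≲ 0.00122`) becomes the operator-norm
tolerance `ε₁ ≃ 0.00122` of Lemma 6.10 — the hypothesis `‖K − T‖ ≤ ε₁` of the tree's
`Literature.NumberTheory.ConnesConsani2021.re_inner_sub_le_of_rankOne_decomposition`
(`RankOnePositivity.lean`).

**What is PROVED here** (any interval `I = [a, b]`, kernels integrated over `[a − b, b − a]`; CC's case
is `a = −½ log 2`, `b = ½ log 2`, so that `[a − b, b − a] = [−log 2, log 2]` literally):

* `corrFun ξ η v = ∫ ξ(x) η̄(x+v) dx` (CC's `f = ξ ∗ ξ*`, polarised) and the Schwarz step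
  `|∫ ξ(x) η̄(x+v) dx| ≤ ‖ξ‖₂ ‖η‖₂` — `norm_corrFun_le`;
* the kernel form `kernelForm a b κ ξ η = ∫_{a−b}^{b−a} (∫ ξ(x) η̄(x+v) dx) κ(v) dv` and the displayed
  inequality of the printed proof, `|kernelForm κ ξ η| ≤ ‖κ‖_{L¹[a−b,b−a]} ‖ξ‖₂ ‖η‖₂` —
  `norm_kernelForm_le`; for `ξ, η ∈ L²(I)` extended by zero (`zeroExt`, `windowForm`) —
  `norm_windowForm_le`;
* **Lemma 6.3** for any two bounded operators `K, T` on `L²(I)` whose (polarised) forms are the kernel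
  forms of `ϖ, τ ∈ L¹`: `‖K − T‖ ≤ ∫_{a−b}^{b−a} |τ − ϖ|` — `opNorm_sub_le_of_windowForm`; with the
  `L¹` distance presented as in Fact 6.1 for an even difference, `2∫₀^{b−a} |τ − ϖ| ≤ ε ⇒ ‖K − T‖ ≤ ε`
  — `opNorm_sub_le_of_windowForm_even`;
* "**the operator defined by (opkf)**" (Prop. 5.5), for every `κ ∈ L¹[a−b, b−a]`: there is a bounded
  operator `windowOp κ` on `L²(I)` with `⟨η | windowOp κ ξ⟩ = windowForm κ ξ η` (`inner_windowOp`),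
  it is the unique bounded operator with this polarised form (`windowOp_unique`) and already the unique
  one with the QUADRATIC form `⟨ξ | K ξ⟩ = windowForm κ ξ ξ` stated in (opkf)/(kT)
  (`windowOp_unique_of_quadratic`, polarisation on a complex Hilbert space), and
  `‖windowOp κ‖ ≤ ‖κ‖_{L¹}` (`norm_windowOp_le`);
* **Lemma 6.3 in its literal form**: if `⟨ξ|K(ξ)⟩ = ∫∫ ξ(x) ξ̄(x+v) ϖ(v) dx dv` and
  `⟨ξ|T(ξ)⟩ = ∫∫ ξ(x) ξ̄(x+v) τ(v) dx dv` for all `ξ ∈ L²(I)` and `‖τ − ϖ‖_{L¹} ≤ ε`, then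
  `‖K − T‖ ≤ ε` — `opNorm_sub_le_of_quadraticForm` (via `norm_windowOp_sub_windowOp_le`);
* "both `T` and `𝐊_I` are self-adjoint" (§6.7 p. 28): for a Hermitian kernel, `κ(−v) = conj κ(v)`
  (CC's `ϖ`, `τ` are real and even), `windowOp κ` is self-adjoint — `inner_windowOp_symm`,
  `isSelfAdjoint_windowOp`; this is the symmetry hypothesis under which `RankOnePositivity.lean`
  derives the decomposition `T = λ_max|η⟩⟨η| + R`, `R ≤ λ₂ P_η` from a top eigenpair
  (`re_inner_sub_le_of_selfAdjoint_eigenvector`).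

Not typed here: compactness / Hilbert–Schmidt class of `𝐊_I` (Prop. 5.5 (ii)), the operator `N_I`
and the identity `⟨ξ|N_I(ξ)⟩ = E₊(Q₊ f)` (Prop. 5.5 (i), which needs the prolate series `ε` of §5),
the specific kernels `ϖ` (§5) and `τ` (supplementary tables, §6.2–6.3), and Fact 6.1 itself (a
floating-point `L¹` computation).  No RH claim; no named fact is introduced (cell `pub-rhdoor`,
`HOME/lit/CC2021-RIGOUR-MAP.md` §1 item 7b).
-/

noncomputable section

open MeasureTheory Set Complex
open scoped ComplexConjugate InnerProductSpace ENNReal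

namespace Literature.NumberTheory.ConnesConsani2021

/-! ## The correlation `f(v) = ∫ ξ(x) η̄(x+v) dx` and the Schwarz step -/

/-- CC's `f(v) = ∫ ξ(x) ξ̄(x+v) dx` (`f = ξ ∗ ξ*`, Prop. 5.5 (i), p. 20), polarised to two functions
`ξ, η` on `ℝ`: `corrFun ξ η v = ∫ ξ(x) η̄(x+v) dx`. [cite: ConnesConsani2021, Prop. 5.5 (i) §5 p. 20] -/
def corrFun (ξ η : ℝ → ℂ) (v : ℝ) : ℂ := ∫ x, ξ x * conj (η (x + v))

variable {ξ η ξ₁ ξ₂ η₁ η₂ κ ϖ τ : ℝ → ℂ} {a b : ℝ}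

/-- A translate of an `L²` function is `L²` (Lebesgue measure is translation invariant). [folklore] -/
private theorem memLp_shift (hη : MemLp η 2 volume) (v : ℝ) :
    MemLp (fun x ↦ η (x + v)) 2 volume :=
  hη.comp_measurePreserving (measurePreserving_add_right volume v)

/-- The integrand `ξ(x) η̄(x+v)` of `corrFun` is integrable for `ξ, η ∈ L²(ℝ)`. [folklore] -/
private theorem integrable_mul_conj_shift (hξ : MemLp ξ 2 volume) (hη : MemLp η 2 volume) (v : ℝ) :
    Integrable (fun x ↦ ξ x * conj (η (x + v))) volume := by
  have h2 : MemLp (fun x ↦ conj (η (x + v))) 2 volume :=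
    (memLp_shift hη v).of_le (memLp_shift hη v).1.star
      (Filter.Eventually.of_forall fun x => (RCLike.norm_conj _).le)
  exact hξ.integrable_mul h2

/-- **The Schwarz step of the proof of Lemma 6.3** (p. 25: "`|∫ ξ(x) ξ(x+v) dx| ≤ ‖ξ‖²`"),
polarised: `|∫ ξ(x) η̄(x+v) dx| ≤ ‖ξ‖₂ ‖η‖₂` for `ξ, η ∈ L²(ℝ)`, for every `v`.
[cite: ConnesConsani2021, Lemma 6.3 §6.4 p. 25 (proof)] -/
theorem norm_corrFun_le (hξ : MemLp ξ 2 volume) (hη : MemLp η 2 volume) (v : ℝ) :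
    ‖corrFun ξ η v‖ ≤ (eLpNorm ξ 2 volume).toReal * (eLpNorm η 2 volume).toReal := by
  have hηv := memLp_shift hη v
  have hinner : ⟪hηv.toLp _, hξ.toLp _⟫_ℂ = corrFun ξ η v := by
    rw [L2.inner_def, corrFun]
    refine integral_congr_ae ?_
    filter_upwards [hηv.coeFn_toLp, hξ.coeFn_toLp] with x hx1 hx2
    rw [hx1, hx2, RCLike.inner_apply]
  calc ‖corrFun ξ η v‖ = ‖⟪hηv.toLp _, hξ.toLp _⟫_ℂ‖ := by rw [hinner]
    _ ≤ ‖hηv.toLp _‖ * ‖hξ.toLp _‖ := norm_inner_le_norm _ _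
    _ = (eLpNorm η 2 volume).toReal * (eLpNorm ξ 2 volume).toReal := by
        rw [Lp.norm_toLp, Lp.norm_toLp, show (fun x ↦ η (x + v)) = η ∘ (· + v) from rfl,
          eLpNorm_comp_measurePreserving hη.1 (measurePreserving_add_right volume v)]
    _ = _ := mul_comm _ _

/-- `v ↦ ∫ ξ(x) η̄(x+v) dx` is (a.e. strongly) measurable (Fubini integrand). [folklore] -/
private theorem aestronglyMeasurable_corrFun (hξ : AEStronglyMeasurable ξ volume)
    (hη : AEStronglyMeasurable η volume) : AEStronglyMeasurable (corrFun ξ η) volume := by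
  have hF : AEStronglyMeasurable (fun z : ℝ × ℝ ↦ ξ z.2 * conj (η (z.2 + z.1)))
      ((volume : Measure ℝ).prod volume) :=
    hξ.comp_snd.mul
      (hη.comp_quasiMeasurePreserving (quasiMeasurePreserving_add_swap volume volume)).star
  exact hF.integral_prod_right'

/-- Additivity of `corrFun` in the first function (for `L²` functions). [folklore] -/
private theorem corrFun_add_left (h₁ : MemLp ξ₁ 2 volume) (h₂ : MemLp ξ₂ 2 volume)
    (hη : MemLp η 2 volume) (v : ℝ) :
    corrFun (ξ₁ + ξ₂) η v = corrFun ξ₁ η v + corrFun ξ₂ η v := by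
  simp only [corrFun, Pi.add_apply, add_mul]
  exact integral_add (integrable_mul_conj_shift h₁ hη v) (integrable_mul_conj_shift h₂ hη v)

/-- Additivity of `corrFun` in the second function (for `L²` functions). [folklore] -/
private theorem corrFun_add_right (hξ : MemLp ξ 2 volume) (h₁ : MemLp η₁ 2 volume)
    (h₂ : MemLp η₂ 2 volume) (v : ℝ) :
    corrFun ξ (η₁ + η₂) v = corrFun ξ η₁ v + corrFun ξ η₂ v := by
  simp only [corrFun, Pi.add_apply, map_add, mul_add]
  exact integral_add (integrable_mul_conj_shift hξ h₁ v) (integrable_mul_conj_shift hξ h₂ v)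

/-- Homogeneity of `corrFun` in the first function. [folklore] -/
private theorem corrFun_smul_left (c : ℂ) (ξ η : ℝ → ℂ) (v : ℝ) :
    corrFun (c • ξ) η v = c * corrFun ξ η v := by
  simp only [corrFun, Pi.smul_apply, smul_eq_mul, mul_assoc]
  exact integral_const_mul c _

/-- Conjugate homogeneity of `corrFun` in the second function. [folklore] -/
private theorem corrFun_smul_right (c : ℂ) (ξ η : ℝ → ℂ) (v : ℝ) :
    corrFun ξ (c • η) v = conj c * corrFun ξ η v := by
  simp only [corrFun, Pi.smul_apply, smul_eq_mul, map_mul]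
  rw [← integral_const_mul]
  congr 1; funext x; ring

/-- `corrFun` only depends on the a.e. classes of its arguments. [folklore] -/
private theorem corrFun_congr_ae (h₁ : ξ₁ =ᵐ[volume] ξ₂) (h₂ : η₁ =ᵐ[volume] η₂) (v : ℝ) :
    corrFun ξ₁ η₁ v = corrFun ξ₂ η₂ v := by
  refine integral_congr_ae ?_
  have h₂' : (fun x ↦ η₁ (x + v)) =ᵐ[volume] fun x ↦ η₂ (x + v) :=
    (measurePreserving_add_right volume v).quasiMeasurePreserving.ae_eq_comp h₂
  filter_upwards [h₁, h₂'] with x hx1 hx2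
  simp only [hx1, hx2]

/-! ## The kernel form `∫∫ ξ(x) η̄(x+v) κ(v) dx dv` and the inequality of the printed proof -/

/-- The (polarised) kernel form of (opkf)/(kT): for an interval `I = [a, b]` and a kernel `κ` on
`[a − b, b − a]`, `kernelForm a b κ ξ η = ∫_{a−b}^{b−a} (∫ ξ(x) η̄(x+v) dx) κ(v) dv`; CC's
`⟨ξ|𝐊_I(ξ)⟩` is `kernelForm (−½log 2) (½log 2) ϖ ξ ξ` and `⟨ξ|T(ξ)⟩` is the same with `τ`.
[cite: ConnesConsani2021, Prop. 5.5 (ii) §5 p. 20 and Lemma 6.3 §6.4 p. 24–25] -/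
def kernelForm (a b : ℝ) (κ : ℝ → ℂ) (ξ η : ℝ → ℂ) : ℂ :=
  ∫ v in Icc (a - b) (b - a), corrFun ξ η v * κ v

/-- The integrand `v ↦ f(v) κ(v)` of the kernel form is integrable on `[a−b, b−a]` when
`κ ∈ L¹[a−b, b−a]` and `ξ, η ∈ L²` (`f` is bounded by `‖ξ‖₂‖η‖₂` and measurable). [folklore] -/
private theorem integrable_corrFun_mul (hκ : IntegrableOn κ (Icc (a - b) (b - a)))
    (hξ : MemLp ξ 2 volume) (hη : MemLp η 2 volume) :
    IntegrableOn (fun v ↦ corrFun ξ η v * κ v) (Icc (a - b) (b - a)) :=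
  Integrable.bdd_mul hκ (aestronglyMeasurable_corrFun hξ.1 hη.1).restrict
    (Filter.Eventually.of_forall fun v => norm_corrFun_le hξ hη v)

/-- **The inequality of the printed proof of Lemma 6.3** (p. 25, display (ineqbasic)), polarised:
`|∫_{a−b}^{b−a} ∫ ξ(x) η̄(x+v) a(v) dx dv| ≤ (∫_{a−b}^{b−a} |a(v)| dv) ‖ξ‖₂ ‖η‖₂` for `a ∈ L¹`,
`ξ, η ∈ L²(ℝ)`, "which follows from the Schwarz inequality" `norm_corrFun_le`.
[cite: ConnesConsani2021, Lemma 6.3 §6.4 p. 25 (proof)] -/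
theorem norm_kernelForm_le (hκ : IntegrableOn κ (Icc (a - b) (b - a))) (hξ : MemLp ξ 2 volume)
    (hη : MemLp η 2 volume) :
    ‖kernelForm a b κ ξ η‖ ≤ (∫ v in Icc (a - b) (b - a), ‖κ v‖) *
      ((eLpNorm ξ 2 volume).toReal * (eLpNorm η 2 volume).toReal) := by
  set A := (eLpNorm ξ 2 volume).toReal * (eLpNorm η 2 volume).toReal with hA
  have hA0 : 0 ≤ A := by positivity
  calc ‖kernelForm a b κ ξ η‖ ≤ ∫ v in Icc (a - b) (b - a), ‖corrFun ξ η v * κ v‖ :=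
        norm_integral_le_integral_norm _
    _ ≤ ∫ v in Icc (a - b) (b - a), ‖κ v‖ * A := by
        refine integral_mono_of_nonneg (Filter.Eventually.of_forall fun v => norm_nonneg _)
          (hκ.norm.mul_const A) (Filter.Eventually.of_forall fun v => ?_)
        simp only [norm_mul]
        calc ‖corrFun ξ η v‖ * ‖κ v‖ ≤ A * ‖κ v‖ :=
              mul_le_mul_of_nonneg_right (norm_corrFun_le hξ hη v) (norm_nonneg _)
          _ = ‖κ v‖ * A := mul_comm _ _
    _ = (∫ v in Icc (a - b) (b - a), ‖κ v‖) * A := integral_mul_const A _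

/-- The kernel form is additive in the kernel (both kernels in `L¹`). [folklore] -/
private theorem kernelForm_sub_kernel (hϖ : IntegrableOn ϖ (Icc (a - b) (b - a)))
    (hτ : IntegrableOn τ (Icc (a - b) (b - a))) (hξ : MemLp ξ 2 volume) (hη : MemLp η 2 volume) :
    kernelForm a b ϖ ξ η - kernelForm a b τ ξ η = kernelForm a b (ϖ - τ) ξ η := by
  simp only [kernelForm, Pi.sub_apply, mul_sub]
  exact (integral_sub (integrable_corrFun_mul hϖ hξ hη) (integrable_corrFun_mul hτ hξ hη)).symm

/-! ## `L²(I)`: zero extension and the forms of (opkf)/(kT) -/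

/-- Zero extension of `ξ ∈ L²([a, b])` to a function on `ℝ` ("`ξ ∈ 𝓗 = L²(I, dx)`" integrated over
`ℝ` in (opkf)). [cite: ConnesConsani2021, Prop. 5.5 §5 p. 20] -/
def zeroExt (ξ : Lp ℂ 2 (volume.restrict (Icc a b))) : ℝ → ℂ := (Icc a b).indicator ξ

/-- The zero extension is in `L²(ℝ)`. [folklore] -/
private theorem memLp_zeroExt (ξ : Lp ℂ 2 (volume.restrict (Icc a b))) : MemLp (zeroExt ξ) 2 volume :=
  (memLp_indicator_iff_restrict measurableSet_Icc).2 (Lp.memLp ξ)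

/-- `‖zeroExt ξ‖_{L²(ℝ)} = ‖ξ‖_{L²(I)}`. [folklore] -/
private theorem eLpNorm_zeroExt (ξ : Lp ℂ 2 (volume.restrict (Icc a b))) :
    (eLpNorm (zeroExt ξ) 2 volume).toReal = ‖ξ‖ := by
  rw [zeroExt, eLpNorm_indicator_eq_eLpNorm_restrict measurableSet_Icc, Lp.norm_def]

/-- From an a.e. identity on `I` to an a.e. identity of zero extensions. [folklore] -/
private theorem indicator_ae_eq_of_restrict {f g : ℝ → ℂ} (h : f =ᵐ[volume.restrict (Icc a b)] g) :
    (Icc a b).indicator f =ᵐ[volume] (Icc a b).indicator g := by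
  filter_upwards [(ae_restrict_iff' measurableSet_Icc).1 h] with x hx
  by_cases hxs : x ∈ Icc a b
  · simp only [Set.indicator_of_mem hxs, hx hxs]
  · simp only [Set.indicator_of_notMem hxs]

/-- `zeroExt (ξ₁ + ξ₂) = zeroExt ξ₁ + zeroExt ξ₂` a.e. [folklore] -/
private theorem zeroExt_add (ξ₁ ξ₂ : Lp ℂ 2 (volume.restrict (Icc a b))) :
    zeroExt (ξ₁ + ξ₂) =ᵐ[volume] zeroExt ξ₁ + zeroExt ξ₂ := by
  have h := indicator_ae_eq_of_restrict (Lp.coeFn_add ξ₁ ξ₂)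
  rw [Set.indicator_add'] at h
  exact h

/-- `zeroExt (c • ξ) = c • zeroExt ξ` a.e. [folklore] -/
private theorem zeroExt_smul (c : ℂ) (ξ : Lp ℂ 2 (volume.restrict (Icc a b))) :
    zeroExt (c • ξ) =ᵐ[volume] c • zeroExt ξ := by
  filter_upwards [(ae_restrict_iff' measurableSet_Icc).1 (Lp.coeFn_smul c ξ)] with x hx
  by_cases hxs : x ∈ Icc a b
  · simp only [zeroExt, Pi.smul_apply, Set.indicator_of_mem hxs, hx hxs]
  · simp only [zeroExt, Pi.smul_apply, Set.indicator_of_notMem hxs, smul_zero]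

/-- The (polarised) forms (opkf)/(kT) on `𝓗 = L²(I, dx)`, `I = [a, b]`:
`windowForm a b κ ξ η = ∫_{a−b}^{b−a} ∫ ξ(x) η̄(x+v) κ(v) dx dv` with `ξ, η ∈ L²(I)` extended by zero;
`windowForm (−½log 2) (½log 2) ϖ ξ ξ` is CC's `⟨ξ|𝐊_I(ξ)⟩`, and with `τ` it is `⟨ξ|T(ξ)⟩`.
[cite: ConnesConsani2021, Prop. 5.5 (ii) §5 p. 20 and Lemma 6.3 §6.4 p. 24–25] -/
def windowForm (a b : ℝ) (κ : ℝ → ℂ) (ξ η : Lp ℂ 2 (volume.restrict (Icc a b))) : ℂ :=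
  kernelForm a b κ (zeroExt ξ) (zeroExt η)

/-- The bound of the printed proof on `L²(I)`: `|windowForm κ ξ η| ≤ ‖κ‖_{L¹[a−b,b−a]} ‖ξ‖ ‖η‖`.
[cite: ConnesConsani2021, Lemma 6.3 §6.4 p. 25 (proof)] -/
theorem norm_windowForm_le (hκ : IntegrableOn κ (Icc (a - b) (b - a)))
    (ξ η : Lp ℂ 2 (volume.restrict (Icc a b))) :
    ‖windowForm a b κ ξ η‖ ≤ (∫ v in Icc (a - b) (b - a), ‖κ v‖) * (‖ξ‖ * ‖η‖) := by
  have h := norm_kernelForm_le hκ (memLp_zeroExt ξ) (memLp_zeroExt η)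
  rwa [eLpNorm_zeroExt, eLpNorm_zeroExt] at h

/-! ## Lemma 6.3 -/

/-- **Connes–Consani 2021, Lemma 6.3** (arXiv Lemma 36, p. 24; proof p. 25), for any two bounded
operators on `𝓗 = L²(I, dx)` given by kernel forms: if `⟨η|K(ξ)⟩ = ∫∫ ξ(x) η̄(x+v) ϖ(v) dx dv` and
`⟨η|T(ξ)⟩ = ∫∫ ξ(x) η̄(x+v) τ(v) dx dv` with `ϖ, τ ∈ L¹[a−b, b−a]` and
`∫_{a−b}^{b−a} |τ − ϖ| ≤ ε`, then `‖K − T‖ ≤ ε` ("the compact operator `𝐊_I` of (opkf) … is at norm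
distance less than `ε` from the finite rank operator `T`").  In the source `I = [−½log 2, ½log 2]`,
`ϖ(v) = (Qε)(e^{|v|})/(2ε′(1₊))`, `τ = τ(λ,α,d,1732)` and `ε = ε₁ ≃ 0.00122` (Fact 6.1); the output
`‖𝐊_I − T‖ ≤ ε₁` is the hypothesis `hKT` of `re_inner_sub_le_of_rankOne_decomposition`.
[cite: ConnesConsani2021, Lemma 6.3 §6.4 p. 24] -/
theorem opNorm_sub_le_of_windowForm
    {K T : Lp ℂ 2 (volume.restrict (Icc a b)) →L[ℂ] Lp ℂ 2 (volume.restrict (Icc a b))}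
    (hϖ : IntegrableOn ϖ (Icc (a - b) (b - a))) (hτ : IntegrableOn τ (Icc (a - b) (b - a)))
    (hK : ∀ ξ η, ⟪η, K ξ⟫_ℂ = windowForm a b ϖ ξ η) (hT : ∀ ξ η, ⟪η, T ξ⟫_ℂ = windowForm a b τ ξ η)
    {ε : ℝ} (hε : ∫ v in Icc (a - b) (b - a), ‖τ v - ϖ v‖ ≤ ε) : ‖K - T‖ ≤ ε := by
  have hε0 : 0 ≤ ε := le_trans (integral_nonneg fun v => norm_nonneg _) hε
  refine Literature.Analysis.OperatorTheory.opNorm_le_of_inner_le (K - T) hε0 fun ξ η => ?_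
  have hform : ⟪η, (K - T) ξ⟫_ℂ = windowForm a b (ϖ - τ) ξ η := by
    rw [show (K - T) ξ = K ξ - T ξ from rfl, inner_sub_right, hK, hT]
    exact kernelForm_sub_kernel hϖ hτ (memLp_zeroExt ξ) (memLp_zeroExt η)
  have hL1 : ∫ v in Icc (a - b) (b - a), ‖(ϖ - τ) v‖ ≤ ε := by
    simpa only [Pi.sub_apply, norm_sub_rev] using hε
  calc ‖⟪(K - T) ξ, η⟫_ℂ‖ = ‖⟪η, (K - T) ξ⟫_ℂ‖ := by rw [← inner_conj_symm, RCLike.norm_conj]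
    _ = ‖windowForm a b (ϖ - τ) ξ η‖ := by rw [hform]
    _ ≤ (∫ v in Icc (a - b) (b - a), ‖(ϖ - τ) v‖) * (‖ξ‖ * ‖η‖) :=
        norm_windowForm_le (hϖ.sub hτ) ξ η
    _ ≤ ε * (‖ξ‖ * ‖η‖) := mul_le_mul_of_nonneg_right hL1 (by positivity)
    _ = ε * ‖ξ‖ * ‖η‖ := (mul_assoc _ _ _).symm

/-- For an even integrable function the `L¹` norm over `[−L, L]` is twice that over `[0, L]` (the
form in which Fact 6.1 states the `L¹` distance: `2∫₀^{log 2} |τ − ϖ|`). [folklore] -/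
private theorem integral_norm_Icc_symm_of_even {g : ℝ → ℂ} {L : ℝ} (hL : 0 ≤ L)
    (hg : IntegrableOn g (Icc (-L) L)) (heven : ∀ v, g (-v) = g v) :
    ∫ v in Icc (-L) L, ‖g v‖ = 2 * ∫ v in Icc 0 L, ‖g v‖ := by
  have hgi : IntervalIntegrable (fun v ↦ ‖g v‖) volume (-L) L := by
    rw [intervalIntegrable_iff_integrableOn_Icc_of_le (by linarith)]
    exact hg.norm
  have h0L : IntervalIntegrable (fun v ↦ ‖g v‖) volume 0 L :=
    hgi.mono_set (by
      rw [uIcc_of_le hL, uIcc_of_le (by linarith : -L ≤ L)]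
      exact Icc_subset_Icc (by linarith) le_rfl)
  have hL0 : IntervalIntegrable (fun v ↦ ‖g v‖) volume (-L) 0 :=
    hgi.mono_set (by
      rw [uIcc_of_le (by linarith : -L ≤ 0), uIcc_of_le (by linarith : -L ≤ L)]
      exact Icc_subset_Icc le_rfl hL)
  rw [integral_Icc_eq_integral_Ioc, ← intervalIntegral.integral_of_le (by linarith),
    integral_Icc_eq_integral_Ioc, ← intervalIntegral.integral_of_le hL,
    ← intervalIntegral.integral_add_adjacent_intervals hL0 h0L]
  have hneg : ∫ v in (-L)..0, ‖g v‖ = ∫ v in (0)..L, ‖g v‖ := by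
    have h : (∫ v in (0 : ℝ)..L, ‖g (-v)‖) = ∫ v in (-L)..(-0), ‖g v‖ :=
      intervalIntegral.integral_comp_neg (fun v ↦ ‖g v‖)
    simp only [heven, neg_zero] at h
    exact h.symm
  rw [hneg, two_mul]

/-- **Lemma 6.3 with the `L¹` distance presented as in Fact 6.1**: if the difference `τ − ϖ` is even
(both kernels are even in the source: `ϖ(v) = (Qε)(e^{|v|})/(2ε′(1₊))`, `τ` a cosine sum) and
`2∫₀^{b−a} |τ − ϖ| ≤ ε` (Fact 6.1: `2∫₀^{log 2} |τ(x) − ϖ(x)| dx ≲ 0.00122`), then `‖K − T‖ ≤ ε`.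
[cite: ConnesConsani2021, Lemma 6.3 §6.4 p. 24 and Fact 6.1 §6.3 p. 24] -/
theorem opNorm_sub_le_of_windowForm_even (hab : a ≤ b)
    {K T : Lp ℂ 2 (volume.restrict (Icc a b)) →L[ℂ] Lp ℂ 2 (volume.restrict (Icc a b))}
    (hϖ : IntegrableOn ϖ (Icc (a - b) (b - a))) (hτ : IntegrableOn τ (Icc (a - b) (b - a)))
    (hK : ∀ ξ η, ⟪η, K ξ⟫_ℂ = windowForm a b ϖ ξ η) (hT : ∀ ξ η, ⟪η, T ξ⟫_ℂ = windowForm a b τ ξ η)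
    (heven : ∀ v, τ (-v) - ϖ (-v) = τ v - ϖ v)
    {ε : ℝ} (hε : 2 * ∫ v in Icc 0 (b - a), ‖τ v - ϖ v‖ ≤ ε) : ‖K - T‖ ≤ ε := by
  refine opNorm_sub_le_of_windowForm hϖ hτ hK hT ?_
  have hd : IntegrableOn (fun v ↦ τ v - ϖ v) (Icc (-(b - a)) (b - a)) := by
    rw [show -(b - a) = a - b by ring]; exact hτ.sub hϖ
  have h := integral_norm_Icc_symm_of_even (g := fun v ↦ τ v - ϖ v) (by linarith) hd heven
  rw [show -(b - a) = a - b by ring] at h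
  rwa [h]

/-! ## The kernel forms define bounded operators (the sense of Prop. 5.5 (i)) -/

section Operator

variable (a b)

/-- The form `(η, ξ) ↦ windowForm κ ξ η` as a bounded sesquilinear form on `L²(I)` (conjugate-linear
in `η`, linear in `ξ`), of norm `≤ ‖κ‖_{L¹[a−b,b−a]}`. [folklore] -/
private def windowSesq (hκ : IntegrableOn κ (Icc (a - b) (b - a))) :
    Lp ℂ 2 (volume.restrict (Icc a b)) →L⋆[ℂ] Lp ℂ 2 (volume.restrict (Icc a b)) →L[ℂ] ℂ :=
  LinearMap.mkContinuous₂
    (LinearMap.mk₂'ₛₗ (starRingEnd ℂ) (RingHom.id ℂ) (fun η ξ ↦ windowForm a b κ ξ η)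
      (fun η₁ η₂ ξ ↦ by
        simp only [windowForm, kernelForm]
        rw [← integral_add (integrable_corrFun_mul hκ (memLp_zeroExt ξ) (memLp_zeroExt η₁))
          (integrable_corrFun_mul hκ (memLp_zeroExt ξ) (memLp_zeroExt η₂))]
        congr 1; funext v
        rw [corrFun_congr_ae Filter.EventuallyEq.rfl (zeroExt_add η₁ η₂),
          corrFun_add_right (memLp_zeroExt ξ) (memLp_zeroExt η₁) (memLp_zeroExt η₂), add_mul])
      (fun c η ξ ↦ by
        simp only [windowForm, kernelForm, starRingEnd_apply, smul_eq_mul]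
        rw [← integral_const_mul]
        congr 1; funext v
        rw [corrFun_congr_ae Filter.EventuallyEq.rfl (zeroExt_smul c η), corrFun_smul_right,
          star_def, mul_assoc])
      (fun η ξ₁ ξ₂ ↦ by
        simp only [windowForm, kernelForm]
        rw [← integral_add (integrable_corrFun_mul hκ (memLp_zeroExt ξ₁) (memLp_zeroExt η))
          (integrable_corrFun_mul hκ (memLp_zeroExt ξ₂) (memLp_zeroExt η))]
        congr 1; funext v
        rw [corrFun_congr_ae (zeroExt_add ξ₁ ξ₂) Filter.EventuallyEq.rfl,
          corrFun_add_left (memLp_zeroExt ξ₁) (memLp_zeroExt ξ₂) (memLp_zeroExt η), add_mul])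
      (fun c η ξ ↦ by
        simp only [windowForm, kernelForm, RingHom.id_apply, smul_eq_mul]
        rw [← integral_const_mul]
        congr 1; funext v
        rw [corrFun_congr_ae (zeroExt_smul c ξ) Filter.EventuallyEq.rfl, corrFun_smul_left,
          mul_assoc]))
    (∫ v in Icc (a - b) (b - a), ‖κ v‖)
    (fun η ξ ↦ by
      rw [LinearMap.mk₂'ₛₗ_apply, mul_assoc, mul_comm ‖η‖]
      exact norm_windowForm_le hκ ξ η)

/-- Unfolding `windowSesq`. [folklore] -/
private theorem windowSesq_apply (hκ : IntegrableOn κ (Icc (a - b) (b - a)))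
    (η ξ : Lp ℂ 2 (volume.restrict (Icc a b))) : windowSesq a b hκ η ξ = windowForm a b κ ξ η := by
  simp [windowSesq]

/-- **The bounded operator on `𝓗 = L²(I, dx)` defined by the kernel form** of an `L¹` kernel `κ`
(the sense in which Prop. 5.5 (ii) speaks of "the compact operator `𝐊_I` defined by (opkf)" and
Lemma 6.3 of "the finite rank operator `T`" through (kT)):
`⟨η | windowOp κ ξ⟩ = ∫_{a−b}^{b−a} ∫ ξ(x) η̄(x+v) κ(v) dx dv` (`inner_windowOp`); obtained from the
bounded sesquilinear form by the Riesz representation. [cite: ConnesConsani2021, Prop. 5.5 (ii) §5 p. 20] -/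
def windowOp (hκ : IntegrableOn κ (Icc (a - b) (b - a))) :
    Lp ℂ 2 (volume.restrict (Icc a b)) →L[ℂ] Lp ℂ 2 (volume.restrict (Icc a b)) :=
  ContinuousLinearMap.adjoint
    (InnerProductSpace.continuousLinearMapOfBilin (windowSesq a b hκ))

variable {a b}

/-- **Defining identity (opkf)/(kT), polarised**: `⟨η | windowOp κ ξ⟩ = windowForm κ ξ η`.
[cite: ConnesConsani2021, Prop. 5.5 (ii) §5 p. 20] -/
theorem inner_windowOp (hκ : IntegrableOn κ (Icc (a - b) (b - a)))
    (ξ η : Lp ℂ 2 (volume.restrict (Icc a b))) :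
    ⟪η, windowOp a b hκ ξ⟫_ℂ = windowForm a b κ ξ η := by
  rw [windowOp, ContinuousLinearMap.adjoint_inner_right,
    InnerProductSpace.continuousLinearMapOfBilin_apply, windowSesq_apply]

/-- **Uniqueness**: a bounded operator on `L²(I)` is determined by the polarised identity (opkf)
("the … operator defined by (opkf)"). [cite: ConnesConsani2021, Prop. 5.5 (ii) §5 p. 20] -/
theorem windowOp_unique (hκ : IntegrableOn κ (Icc (a - b) (b - a)))
    {K : Lp ℂ 2 (volume.restrict (Icc a b)) →L[ℂ] Lp ℂ 2 (volume.restrict (Icc a b))}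
    (hK : ∀ ξ η, ⟪η, K ξ⟫_ℂ = windowForm a b κ ξ η) : K = windowOp a b hκ := by
  refine ContinuousLinearMap.ext fun ξ => ext_inner_left ℂ fun η => ?_
  rw [hK, inner_windowOp]

/-- **Uniqueness from the quadratic form alone** — the literal shape of (opkf)/(kT), which the source
states for `⟨ξ|·(ξ)⟩` only: on the complex Hilbert space `L²(I)` a bounded operator with
`⟨ξ | K ξ⟩ = windowForm κ ξ ξ` for all `ξ` is `windowOp κ` (polarisation, Mathlib's `ext_inner_map`).
[cite: ConnesConsani2021, Prop. 5.5 (ii) §5 p. 20] -/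
theorem windowOp_unique_of_quadratic (hκ : IntegrableOn κ (Icc (a - b) (b - a)))
    {K : Lp ℂ 2 (volume.restrict (Icc a b)) →L[ℂ] Lp ℂ 2 (volume.restrict (Icc a b))}
    (hK : ∀ ξ, ⟪ξ, K ξ⟫_ℂ = windowForm a b κ ξ ξ) : K = windowOp a b hκ := by
  have h : (K : Lp ℂ 2 (volume.restrict (Icc a b)) →ₗ[ℂ] Lp ℂ 2 (volume.restrict (Icc a b)))
      = (windowOp a b hκ : _ →L[ℂ] _) := by
    refine (ext_inner_map _ _).1 fun ξ => ?_
    rw [ContinuousLinearMap.coe_coe, ContinuousLinearMap.coe_coe, ← inner_conj_symm, hK,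
      ← inner_conj_symm (windowOp a b hκ ξ), inner_windowOp]
  exact ContinuousLinearMap.coe_inj.1 h

/-- **Boundedness with the `L¹` bound**: `‖windowOp κ‖ ≤ ∫_{a−b}^{b−a} |κ|` (Lemma 6.3 against the zero
kernel). [cite: ConnesConsani2021, Prop. 5.5 (ii) §5 p. 20 and Lemma 6.3 §6.4 p. 24] -/
theorem norm_windowOp_le (hκ : IntegrableOn κ (Icc (a - b) (b - a))) :
    ‖windowOp a b hκ‖ ≤ ∫ v in Icc (a - b) (b - a), ‖κ v‖ := by
  have h0 : IntegrableOn (0 : ℝ → ℂ) (Icc (a - b) (b - a)) := integrableOn_zero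
  have hT : ∀ ξ η : Lp ℂ 2 (volume.restrict (Icc a b)),
      ⟪η, (0 : Lp ℂ 2 (volume.restrict (Icc a b)) →L[ℂ] Lp ℂ 2 (volume.restrict (Icc a b))) ξ⟫_ℂ
        = windowForm a b 0 ξ η := fun ξ η => by
    simp [windowForm, kernelForm]
  have h := opNorm_sub_le_of_windowForm hκ h0 (inner_windowOp hκ) hT
    (ε := ∫ v in Icc (a - b) (b - a), ‖κ v‖) (by simp)
  simpa using h

/-- **Lemma 6.3 for the operators so defined**: `‖windowOp ϖ − windowOp τ‖ ≤ ∫_{a−b}^{b−a} |τ − ϖ|`,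
i.e. `𝐊_I = windowOp ϖ` is at norm distance `≤ ‖τ − ϖ‖_{L¹}` from `T = windowOp τ`.
[cite: ConnesConsani2021, Lemma 6.3 §6.4 p. 24] -/
theorem norm_windowOp_sub_windowOp_le (hϖ : IntegrableOn ϖ (Icc (a - b) (b - a)))
    (hτ : IntegrableOn τ (Icc (a - b) (b - a))) :
    ‖windowOp a b hϖ - windowOp a b hτ‖ ≤ ∫ v in Icc (a - b) (b - a), ‖τ v - ϖ v‖ :=
  opNorm_sub_le_of_windowForm hϖ hτ (inner_windowOp hϖ) (inner_windowOp hτ) le_rfl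

/-- **Connes–Consani 2021, Lemma 6.3 — literal form.**  "Let `τ` be an approximation of the function
`ϖ` so that the `L¹` norm of the difference `τ − ϖ` is `≤ ε`.  Then the compact operator `𝐊_I` of
(opkf) … is at norm distance less than `ε` from the finite rank operator `T`" of (kT): for bounded
operators `K, T` on `L²(I)` with `⟨ξ|K(ξ)⟩ = ∫_{a−b}^{b−a} ∫ ξ(x) ξ̄(x+v) ϖ(v) dx dv` and
`⟨ξ|T(ξ)⟩ = ∫_{a−b}^{b−a} ∫ ξ(x) ξ̄(x+v) τ(v) dx dv` for all `ξ` (`ϖ, τ ∈ L¹[a−b, b−a]`) and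
`∫_{a−b}^{b−a} |τ − ϖ| ≤ ε`, `‖K − T‖ ≤ ε`.  (In the source `a = −½ log 2`, `b = ½ log 2`,
`ε = ε₁ ≃ 0.00122`.) [cite: ConnesConsani2021, Lemma 6.3 §6.4 p. 24] -/
theorem opNorm_sub_le_of_quadraticForm
    {K T : Lp ℂ 2 (volume.restrict (Icc a b)) →L[ℂ] Lp ℂ 2 (volume.restrict (Icc a b))}
    (hϖ : IntegrableOn ϖ (Icc (a - b) (b - a))) (hτ : IntegrableOn τ (Icc (a - b) (b - a)))
    (hK : ∀ ξ, ⟪ξ, K ξ⟫_ℂ = windowForm a b ϖ ξ ξ) (hT : ∀ ξ, ⟪ξ, T ξ⟫_ℂ = windowForm a b τ ξ ξ)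
    {ε : ℝ} (hε : ∫ v in Icc (a - b) (b - a), ‖τ v - ϖ v‖ ≤ ε) : ‖K - T‖ ≤ ε := by
  rw [windowOp_unique_of_quadratic hϖ hK, windowOp_unique_of_quadratic hτ hT]
  exact (norm_windowOp_sub_windowOp_le hϖ hτ).trans hε

end Operator

/-! ## Hermitian kernels give self-adjoint operators ("both `T` and `𝐊_I` are self-adjoint", p. 28) -/

section SelfAdjoint

/-- `conj f(v) = ∫ ξ(y) η̄(y − v) dy`: conjugating the correlation swaps the functions and reflects `v`
(translation invariance of Lebesgue measure). [folklore] -/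
private theorem conj_corrFun (ξ η : ℝ → ℂ) (v : ℝ) : conj (corrFun η ξ v) = corrFun ξ η (-v) := by
  simp only [corrFun, ← integral_conj, map_mul, RCLike.conj_conj]
  rw [← integral_add_right_eq_self (fun y ↦ ξ y * conj (η (y + -v))) v]
  congr 1; funext x
  rw [add_neg_cancel_right, mul_comm]

/-- A set integral over the symmetric interval `[a−b, b−a]` is invariant under `v ↦ −v`. [folklore] -/
private theorem setIntegral_Icc_symm_comp_neg {F : Type*} [NormedAddCommGroup F] [NormedSpace ℝ F]
    (G : ℝ → F) : ∫ v in Icc (a - b) (b - a), G (-v) = ∫ v in Icc (a - b) (b - a), G v := by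
  rcases le_or_gt a b with hab | hab
  · have hle : a - b ≤ b - a := by linarith
    rw [integral_Icc_eq_integral_Ioc, ← intervalIntegral.integral_of_le hle,
      integral_Icc_eq_integral_Ioc, ← intervalIntegral.integral_of_le hle,
      intervalIntegral.integral_comp_neg, show -(b - a) = a - b by ring, show -(a - b) = b - a by ring]
  · rw [Icc_eq_empty (by linarith), Measure.restrict_empty, integral_zero_measure,
      integral_zero_measure]

/-- **Hermitian kernels give symmetric forms**: if `κ(−v) = conj κ(v)` (in the source `ϖ` and `τ` are
real-valued and even), then `⟨windowOp κ η | ξ⟩ = ⟨η | windowOp κ ξ⟩` — "both `T` and `𝐊_I` are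
self-adjoint" (p. 28, used for the spectral decomposition of `T` and [Simon] Thm. 1.7).
[cite: ConnesConsani2021, §6.7 p. 28] -/
theorem inner_windowOp_symm (hκ : IntegrableOn κ (Icc (a - b) (b - a)))
    (hherm : ∀ v, κ (-v) = conj (κ v)) (ξ η : Lp ℂ 2 (volume.restrict (Icc a b))) :
    ⟪windowOp a b hκ η, ξ⟫_ℂ = ⟪η, windowOp a b hκ ξ⟫_ℂ := by
  rw [← inner_conj_symm, inner_windowOp, inner_windowOp]
  simp only [windowForm, kernelForm, ← integral_conj, map_mul, conj_corrFun, ← hherm]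
  exact setIntegral_Icc_symm_comp_neg (a := a) (b := b)
    (fun w ↦ corrFun (zeroExt ξ) (zeroExt η) w * κ w)

/-- **Self-adjointness of the operators of (opkf)/(kT) for Hermitian kernels** (`κ(−v) = conj κ(v)`;
CC's `ϖ`, `τ` are real and even): `windowOp κ` is self-adjoint. [cite: ConnesConsani2021, §6.7 p. 28] -/
theorem isSelfAdjoint_windowOp (hκ : IntegrableOn κ (Icc (a - b) (b - a)))
    (hherm : ∀ v, κ (-v) = conj (κ v)) : IsSelfAdjoint (windowOp a b hκ) := by
  rw [ContinuousLinearMap.isSelfAdjoint_iff_isSymmetric]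
  intro η ξ
  exact inner_windowOp_symm hκ hherm ξ η

end SelfAdjoint

end Literature.NumberTheory.ConnesConsani2021

end
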